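import Summits.HubbardSuperconductivity.HubbardSuperconductivity.Theorems.AnisotropyChordTransferFibre3KreinV2

/-!
# Route `AnisotropyChord` / H0 rotor rung: PORT N30-A — the GM₃ certificate theorem WITHOUT the backward Krein half

The certificate logic `CertLogicV2` (memo ROTOR-THEORY-20 §279–§287) takes `KreinThreeV2` (eigenvalue `↔` fixed point) as
a hypothesis, but its proof (`certLogicV2_holds`) only ever uses the FORWARD direction (eigenvalue `⇒` fixed point),
which is the tree theorem `kreinThreeV2_forward` (`L ≥ 4`, `Δ ≠ 0`).  This file records the resulting certificate theorem
with the backward half of KREIN-3 removed from the critical path: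
**`gm3Fibre_of_certificate`** — for `L ≥ 4`, `Δ ≠ 0`, `0 < T* < 2ε₁`: `PhiAntitone`, `NInvertibleBelow T*` (lemma L2),
`T* < Φ(T*)` and a `K = 0` admissible state with Rayleigh quotient `≤ T*` imply `GM3Fibre L Δ`.
So the remaining analytic inputs of the ∀L certificate are exactly `PhiAntitone` and `NInvertibleBelow` (L2), plus the
two numerical checks.  Prover seat `hubbard-h0-rotor-p1` g21; helper for stmt-HubbardSuperconductivity-19089 (`--supports`).
-/

set_option linter.dupNamespace false
set_option autoImplicit false

noncomputable section

open scoped BigOperators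

namespace Summit.HubbardSuperconductivity.HubbardSuperconductivity.Theorems.AnisotropyChord.Transfer.Fibre3

variable (L : ℕ) [NeZero L]

/-- certificate logic with only the forward Krein direction as hypothesis. [folklore] -/
theorem gm3Fibre_of_forward (Δ Tstar : ℝ) (hT2 : Tstar < 2 * eps1 L)
    (hK : ∀ T : ℝ, T < 2 * eps1 L → (Nmat L T Δ).det ≠ 0 →
      IsSectorEigenvalue L (K1 L) Δ (eps1 L + T) → Phi L T Δ = T)
    (hAnti : PhiAntitone L Δ) (hInv : NInvertibleBelow L Δ Tstar) (hPhi : Tstar < Phi L Tstar Δ)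
    (hG : ∃ G : Cfg L → ℂ, Admissible L 0 G ∧ RQ L 0 Δ G ≤ Tstar) : GM3Fibre L Δ := by
  intro F hF
  obtain ⟨G, hGadm, hGle⟩ := hG
  obtain ⟨E, hEeig, hEmin⟩ := sectorMinAttained_holds L (K1 L) Δ F hF
  have hT : Tstar < E - eps1 L := by
    by_contra h
    rw [not_lt] at h
    have hlt2 : E - eps1 L < 2 * eps1 L := lt_of_le_of_lt h hT2
    have hdet : (Nmat L (E - eps1 L) Δ).det ≠ 0 := hInv (E - eps1 L) h
    have hfix : Phi L (E - eps1 L) Δ = E - eps1 L := by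
      apply hK (E - eps1 L) hlt2 hdet
      have e : eps1 L + (E - eps1 L) = E := by ring
      rw [e]; exact hEeig
    have hanti : Phi L Tstar Δ ≤ Phi L (E - eps1 L) Δ :=
      hAnti (E - eps1 L) Tstar h hT2 (fun T hT => hInv T hT.2)
    linarith
  refine ⟨G, hGadm, ?_⟩
  have := hEmin F hF
  linarith

/-- **the GM₃ certificate theorem** (`L ≥ 4`, `Δ ≠ 0`, `T* < 2ε₁`): `Φ` antitone where `𝒩` is invertible, `𝒩(T)` invertible
for `T ≤ T*`, the numerical checks `T* < Φ(T*)` and a `K = 0` admissible state with Rayleigh quotient `≤ T*` — together give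
`GM3Fibre L Δ`; the Krein direction needed is the proved `kreinThreeV2_forward`. [folklore] -/
theorem gm3Fibre_of_certificate (hL : 4 ≤ L) {Δ : ℝ} (hΔ : Δ ≠ 0) (Tstar : ℝ) (hT2 : Tstar < 2 * eps1 L)
    (hAnti : PhiAntitone L Δ) (hInv : NInvertibleBelow L Δ Tstar) (hPhi : Tstar < Phi L Tstar Δ)
    (hG : ∃ G : Cfg L → ℂ, Admissible L 0 G ∧ RQ L 0 Δ G ≤ Tstar) : GM3Fibre L Δ :=
  gm3Fibre_of_forward L Δ Tstar hT2 (fun T hT hdet hE => kreinThreeV2_forward L hL hΔ T hT hdet hE)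
    hAnti hInv hPhi hG

end Summit.HubbardSuperconductivity.HubbardSuperconductivity.Theorems.AnisotropyChord.Transfer.Fibre3

end
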